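import Mathlib
import Summits.NavierStokesRegularity.NavierStokesRegularity.Theorems.BarrierStepRungThreeSOSPolyCalculus
import HarnessLib

/-!
# `BarrierStepRungThree`, LINE g2-2: `sdp2lean` adapters for the STATIC clauses of the window
certificate (properness, clock floor, gradient bound `Λ`)

For a clock `v x := P.eval (L x)` and goal `g x := G.eval (L x)` (`P, G : SOS.Poly`, `L` a linear
coordinate map as in `SOSPolyCalculus`), the three clauses of `WindowCertificateMargin` / K2″ that do
not involve the lattice dynamics are exactly `sdp2lean`-shaped polynomial implications:

* PROPERNESS `v x ≤ 0 → |x i j| ≤ Mw i j` ⟸ `∀ y, P(y) ≤ 0 → y_(k(i,j))² ≤ (Mw i j)²`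
  (`proper_of_sos`; one certificate per window coordinate, `gs = [−P]`);
* CLOCK FLOOR `v x ≤ 0 → 0 < g x → −(γc) < v x` ⟸ `∀ y, P(y) ≤ 0 → 0 ≤ G(y) → −(γc) < P(y)`
  (`floor_of_sos`; `gs = [−P, G]`, target `P + γc − ε`);
* GRADIENT BOUND `v x ≤ 0 → ‖fderiv ℝ v x‖ ≤ Λ` ⟸ per-variable bounds `|∂ₖP(y)| ≤ λ k` on `{P ≤ 0}`
  with `Σ_{k<numVars P} λ k ≤ Λ` and unit-norm coordinates (`opNorm_le_of_sos`).

HONEST FRAMING: plumbing for the certificate FORMAT (MODEL lattice, class rung TL-M3); proves no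
certificate and nothing about the Navier–Stokes equations.
-/

noncomputable section

-- the sub-problem namespace `Summit.NavierStokesRegularity.NavierStokesRegularity` repeats the summit name by design (D-0017)
set_option linter.dupNamespace false

namespace Summit.NavierStokesRegularity.NavierStokesRegularity.Theorems

namespace SOSPolyCalculus

open Finset
open Literature.Computation.Certificates Literature.Computation.Certificates.SOS
open Literature.Computation.Certificates.SOS.Poly

variable {n : ℕ}

/-- **Properness adapter.** If on `{P ≤ 0}` every window coordinate satisfies `y_k² ≤ Mw²`
(`k = 4j+i`, one `sdp2lean` certificate each) with `Mw ≥ 0`, then `v x ≤ 0 → |x i j| ≤ Mw i j` for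
`v := P ∘ L`. [folklore] -/
theorem proper_of_sos (L : (Fin 4 → Fin n → ℝ) →L[ℝ] (ℕ → ℝ))
    (hL : ∀ (x : Fin 4 → Fin n → ℝ) (i : Fin 4) (j : Fin n), L x (4 * (j : ℕ) + (i : ℕ)) = x i j)
    (P : Poly) (Mw : Fin 4 → Fin n → ℝ) (hMw : ∀ i j, 0 ≤ Mw i j)
    (hsos : ∀ (y : ℕ → ℝ) (i : Fin 4) (j : Fin n), (Poly.eval y P : ℝ) ≤ 0 →
      y (4 * (j : ℕ) + (i : ℕ)) ^ 2 ≤ Mw i j ^ 2) :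
    ∀ x : Fin 4 → Fin n → ℝ, (Poly.eval (L x) P : ℝ) ≤ 0 → ∀ (i : Fin 4) (j : Fin n), |x i j| ≤ Mw i j := by
  intro x hx i j
  have h := hsos (L x) i j hx
  rw [hL] at h
  exact abs_le_of_sq_le_sq' (by simpa using h) (hMw i j) |>.elim (fun h1 h2 => abs_le.2 ⟨h1, h2⟩)

/-- **Clock-floor adapter.** If `−(γc) < P(y)` whenever `P(y) ≤ 0 ≤ G(y)` (an `sdp2lean` bound for
`P + γc − ε` on `gs = [−P, G]` gives this with room `ε`), then `v x ≤ 0 → 0 < g x → −(γc) < v x`.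
[folklore] -/
theorem floor_of_sos (L : (Fin 4 → Fin n → ℝ) →L[ℝ] (ℕ → ℝ)) (P G : Poly) (γ c : ℝ)
    (hsos : ∀ y : ℕ → ℝ, (Poly.eval y P : ℝ) ≤ 0 → 0 ≤ (Poly.eval y G : ℝ) → -(γ * c) < (Poly.eval y P : ℝ)) :
    ∀ x : Fin 4 → Fin n → ℝ, (Poly.eval (L x) P : ℝ) ≤ 0 → 0 < (Poly.eval (L x) G : ℝ) →
      -(γ * c) < (Poly.eval (L x) P : ℝ) :=
  fun x hv hg => hsos (L x) hv hg.le

/-- From an `sdp2lean` lower bound with slack: `0 ≤ P(y) + γc − ε` on the region and `0 < ε` give the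
strict floor hypothesis of `floor_of_sos`. [folklore] -/
theorem floor_hyp_of_nonneg (P G : Poly) (γ c ε : ℝ) (hε : 0 < ε)
    (hnn : ∀ y : ℕ → ℝ, 0 ≤ -(Poly.eval y P : ℝ) → 0 ≤ (Poly.eval y G : ℝ) →
      0 ≤ (Poly.eval y P : ℝ) + γ * c - ε) :
    ∀ y : ℕ → ℝ, (Poly.eval y P : ℝ) ≤ 0 → 0 ≤ (Poly.eval y G : ℝ) → -(γ * c) < (Poly.eval y P : ℝ) := by
  intro y hP hG
  have := hnn y (by linarith) hG
  linarith

/-- **Gradient-bound adapter.** With unit-norm coordinates, per-variable bounds `|∂ₖP(y)| ≤ λ k` on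
`{P ≤ 0}` (one `sdp2lean` certificate for each sign and each `k < numVars P`) and `Σ λ k ≤ Λ` give
the clause `v x ≤ 0 → ‖fderiv ℝ v x‖ ≤ Λ`. [folklore] -/
theorem opNorm_le_of_sos {E : Type*} [NormedAddCommGroup E] [NormedSpace ℝ E] (L : E →L[ℝ] (ℕ → ℝ))
    (hL1 : ∀ k, ‖(ContinuousLinearMap.proj (R := ℝ) (φ := fun _ : ℕ => ℝ) k).comp L‖ ≤ 1)
    (P : Poly) (lam : ℕ → ℝ) (Λ : ℝ) (hΛ : ∑ k ∈ range (numVars P), lam k ≤ Λ)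
    (hsos : ∀ (y : ℕ → ℝ), (Poly.eval y P : ℝ) ≤ 0 → ∀ k < numVars P,
      |(Poly.eval y (pderiv k P) : ℝ)| ≤ lam k) :
    ∀ x : E, (Poly.eval (L x) P : ℝ) ≤ 0 → ‖fderiv ℝ (fun x => (Poly.eval (L x) P : ℝ)) x‖ ≤ Λ := by
  intro x hx
  refine (opNorm_fderiv_eval_comp_le_sum_abs L hL1 P x).trans (le_trans ?_ hΛ)
  exact sum_le_sum fun k hk => hsos (L x) hx k (by simpa using hk)

end SOSPolyCalculus

end Summit.NavierStokesRegularity.NavierStokesRegularity.Theorems
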